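import Literature.AlgebraicGeometry.ModuliOfAbelianVarieties.SiegelFineModuliSchemeLevelGroupAction
import Literature.AlgebraicGeometry.AbelianSchemes.PolarizedTripleRigidityOfFiniteType
import Literature.AlgebraicGeometry.AbelianSchemes.PolarizedLevelChange
import Literature.NumberTheory.Adeles.IntegralAdeleResidue
import HarnessLib

/-!
# The level-descent action lifts to the universal triple: `Δ` acts on the total spaces of `𝒰.A`, `𝒰.Â` over its action
# on `A_{g,δ,N}` ([MFK94] Ch. 7 §3 p. 140, Prop. 7.1; [Deligne 1971] 4.16)

Topic `AlgebraicGeometry/ModuliOfAbelianVarieties`; namespace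
`Literature.AlgebraicGeometry.ModuliOfAbelianVarieties.SiegelFineModuliScheme`.  THEOREMS ONLY (no definition, no named
fact, no instance, no notation, no `sorry`; net Literature debt 0).  Cell hodgecm-mathlib (D-0151), F-DAG F-10, the
(10a)↔(b) JUNCTION (O-A): the finite level-descent action `act : Δ →* Aut M` of ★ (Q-lite)
`exists_levelKernel_finite_action` (clauses taken as hypotheses) LIFTS to homomorphisms `autA : Δ →* Aut 𝒰.A`,
`autÂ : Δ →* Aut 𝒰.Â` of the total spaces such that `(autA x, autÂ x)` exhibits the level-`N₀` universal triple
`X := 𝒰.changeLevel N₀` as its own pull-back along `act x` — the equivariance input `hA`/`hX` of the (10a) descent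
files ★ `AbelianSchemeBaseQuotientDescent` … ★ `PolarizedTripleBaseQuotientDescent` (which descend `X` along the free
quotient `M → M/Δ`).  [MumfordFogartyKirwan1994] Ch. 7 §3 p. 140 («`Γ` acts on the universal family») with §1
Prop. 7.1 (descent along a free action); [Deligne1971TravauxShimura] 4.16.  Existence of each lift: `(act x)⁻¹` is a twist
operator `T_γ̄`, and `classify` exhibits `𝒰 · γ̄` as the pull-back of `𝒰` along it (★ `exists_isBaseChangeVia_classifyingMap`);
since `γ̄ ≡ 1 (mod N₀)` (`γ ∈ K_δ(N₀)`; ★ `mem_principalLevelSubgroup_iff_forall_integralAdeleResidue_eq`), `(𝒰 · γ̄).changeLevel N₀`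
has the level structure of `X` (★ `LevelStructure.changeLevel_twist_of_map_eq_one`).  Uniqueness of the lifts — hence the
homomorphism laws via ★ `IsBaseChangeVia.refl` / `.trans` — is RIGIDITY over the finite-type `ℚ`-scheme `M` (★
`IsBaseChangeVia.unique_of_locallyOfFiniteType`, `3 ≤ N₀`).  HC_CM is proved only modulo the 7 printed citations until rung 0
closes; this file discharges none of them (count-neutral capital).

* **`exists_action_on_universal_changeLevel`** — `∃ autA autÂ, ∀ x, X.IsBaseChangeVia X (act x).hom.left (autA x).hom (autÂ x).hom`.

Mathlib searched (pin): `CategoryTheory.Aut` (`Aut.Aut_mul_def`: `f * g = g ≪≫ f`), `Iso.ext`, `MonoidHom` structure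
literal, `Cardinal.mk_eq_aleph0` (all used).

## References
* D. Mumford, J. Fogarty, F. Kirwan, *Geometric Invariant Theory*, 3rd ed. (1994), Ch. 7 §3 (p. 140); §1 Proposition 7.1
  (p. 127). [MumfordFogartyKirwan1994]
* P. Deligne, *Travaux de Shimura*, Sém. Bourbaki 389 (1971), 4.16 p. 150; Exemple 4.16 p. 150. [Deligne1971TravauxShimura]
-/

noncomputable section

open CategoryTheory CategoryTheory.Limits AlgebraicGeometry

namespace Literature.AlgebraicGeometry.ModuliOfAbelianVarieties

open Literature.AlgebraicGeometry.Motives (SchemeOver)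
open Literature.AlgebraicGeometry.AbelianSchemes (PolarizedAbelianSchemeWithLevel)
open Literature.AlgebraicGeometry.AbelianSchemes.AbelianSchemeOver
open Literature.NumberTheory.Adeles NumberField IsDedekindDomain

namespace SiegelFineModuliScheme

variable {g N : ℕ} {δ : Fin g → ℕ} (𝓜 : SiegelFineModuliScheme g N δ) [IsCommMonObj 𝓜.univ.A.X] [NeZero N]

/-- The reduction of `γ ∈ K_δ(N₀)` modulo `N = N₀ d`, read modulo `N₀`, is `1`. [cite: Deligne1971TravauxShimura, Exemple 4.16 p. 150] -/
private theorem map_castHom_eq_one_of_mem' {N₀ d : ℕ} [NeZero N₀] (hd : N = N₀ * d)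
    (red : principalLevelSubgroup δ 1 →* GL (Fin g ⊕ Fin g) (ZMod N))
    (hred : ∀ (k : principalLevelSubgroup δ 1) (i j : Fin g ⊕ Fin g)
      (h : (((k : gspFinAdelic δ) : GL (Fin g ⊕ Fin g) finAdeleQ) :
        Matrix (Fin g ⊕ Fin g) (Fin g ⊕ Fin g) finAdeleQ) i j ∈ FiniteAdeleRing.integralAdeles (𝓞 ℚ) ℚ),
      ((red k : GL (Fin g ⊕ Fin g) (ZMod N)) : Matrix (Fin g ⊕ Fin g) (Fin g ⊕ Fin g) (ZMod N)) i j =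
        integralAdeleResidue N ⟨_, h⟩)
    (k : principalLevelSubgroup δ 1) (hk : (k : gspFinAdelic δ) ∈ principalLevelSubgroup δ N₀) :
    Matrix.GeneralLinearGroup.map (ZMod.castHom (⟨d, hd⟩ : N₀ ∣ N) (ZMod N₀)) (red k) = 1 := by
  have h1 := (mem_principalLevelSubgroup_iff_forall_integralAdeleResidue_eq N₀ δ k.2).1 hk
  refine Units.ext (Matrix.ext fun i j => ?_)
  have hint := isIntegral_of_isCongOne_one ((mem_principalLevelSubgroup_iff δ).1 k.2).1 i j
  rw [Matrix.GeneralLinearGroup.map_apply, Units.val_one, hred k i j hint, ← RingHom.comp_apply,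
    castHom_comp_integralAdeleResidue]
  exact h1 i j

/-- **THE LEVEL-DESCENT ACTION LIFTS TO THE UNIVERSAL LEVEL-`N₀` TRIPLE** ([MumfordFogartyKirwan1994] Ch. 7 §3 p. 140:
«`Γ` acts on `𝒜_{g,d,n}`, hence on `A_{g,d,n}` AND ON THE UNIVERSAL FAMILY» — the input of the descent Prop. 7.1 /
Lemma 7.11; [Deligne1971TravauxShimura] 4.16).  For the finite action `act : Δ →* Aut M` of ★
`exists_levelKernel_finite_action` (its clauses as hypotheses), `N = N₀ d`, `3 ≤ N₀`, `M` locally of finite type over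
`ℚ`: there are homomorphisms `autA : Δ →* Aut 𝒰.A`, `autÂ : Δ →* Aut 𝒰.Â` (automorphisms of the TOTAL SPACES) such that
for every `x ∈ Δ` the pair `(autA x, autÂ x)` exhibits the level-`N₀` universal triple `X := 𝒰.changeLevel N₀` as its
own pull-back along `act x` (★ `IsBaseChangeVia`, all five clauses) — the `hA`/`hX` equivariance input of the (10a)
descent ★ `AbelianSchemeBaseQuotientDescent` / ★ `PolarizedTripleBaseQuotientDescent`.  Existence: `(act x)⁻¹` is a
twist operator `T_γ̄`, `classify` makes `𝒰 · γ̄` the pull-back of `𝒰` along it (★ `exists_isBaseChangeVia_classifyingMap`),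
and `γ̄ ≡ 1 (mod N₀)` makes `(𝒰 · γ̄).changeLevel N₀ = X` (★ `LevelStructure.changeLevel_twist_of_map_eq_one`); the lifts
are UNIQUE by rigidity (★ `IsBaseChangeVia.unique_of_locallyOfFiniteType`, `3 ≤ N₀`), hence multiplicative (★
`IsBaseChangeVia.refl/trans`).
[cite: MumfordFogartyKirwan1994, Ch. 7 §3 (p. 140) and §1 Proposition 7.1 (p. 127)] [cite: Deligne1971TravauxShimura, 4.16 p. 150] -/
theorem exists_action_on_universal_changeLevel [LocallyOfFiniteType 𝓜.M.hom]
    {N₀ d : ℕ} [NeZero N₀] (hd : N = N₀ * d) (hN₀ : 3 ≤ N₀)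
    (red : principalLevelSubgroup δ 1 →* GL (Fin g ⊕ Fin g) (ZMod N))
    (Δ : Subgroup (GL (Fin g ⊕ Fin g) (ZMod N))) (act : Δ →* Aut 𝓜.M)
    (hred : ∀ (k : principalLevelSubgroup δ 1) (i j : Fin g ⊕ Fin g)
      (h : (((k : gspFinAdelic δ) : GL (Fin g ⊕ Fin g) finAdeleQ) :
        Matrix (Fin g ⊕ Fin g) (Fin g ⊕ Fin g) finAdeleQ) i j ∈ FiniteAdeleRing.integralAdeles (𝓞 ℚ) ℚ),
      ((red k : GL (Fin g ⊕ Fin g) (ZMod N)) : Matrix (Fin g ⊕ Fin g) (Fin g ⊕ Fin g) (ZMod N)) i j =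
        integralAdeleResidue N ⟨_, h⟩)
    (hΔ : ∀ x : Δ, ∃ k : principalLevelSubgroup δ 1, (k : gspFinAdelic δ) ∈ principalLevelSubgroup δ N₀ ∧ red k = x)
    (hop : ∀ (k : principalLevelSubgroup δ 1) (hk : red k ∈ Δ),
      ∃ hs : (𝓜.univ.level.twist (red k)).IsSymplecticLiftable 𝓜.univ.pol δ,
        (act ⟨red k, hk⟩).inv = (haveI := 𝓜.isLocallyNoetherian
          𝓜.classifyingMap 𝓜.M ({ 𝓜.univ with level := 𝓜.univ.level.twist (red k), symplectic := hs } :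
            PolarizedAbelianSchemeWithLevel g N δ 𝓜.M.left))) :
    ∃ (autA : Δ →* Aut 𝓜.univ.A.X.left) (autAh : Δ →* Aut 𝓜.univ.D.hat.X.left),
      ∀ x : Δ, (𝓜.univ.changeLevel N₀ d hd (NeZero.ne N)).IsBaseChangeVia
        (𝓜.univ.changeLevel N₀ d hd (NeZero.ne N)) (act x).hom.left (autA x).hom (autAh x).hom := by
  haveI := 𝓜.isLocallyNoetherian
  have hN : N ≠ 0 := NeZero.ne N
  set X : PolarizedAbelianSchemeWithLevel g N₀ δ 𝓜.M.left := 𝓜.univ.changeLevel N₀ d hd hN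
  -- (1) existence of a lift along `(act y)⁻¹` for every `y`, hence along `(act x)` for every `x = y⁻¹`
  have hex_inv : ∀ y : Δ, ∃ (G : 𝓜.univ.A.X.left ⟶ 𝓜.univ.A.X.left)
      (Ĝ : 𝓜.univ.D.hat.X.left ⟶ 𝓜.univ.D.hat.X.left), X.IsBaseChangeVia X (act y).inv.left G Ĝ := by
    intro y
    obtain ⟨k, hkN₀, hky⟩ := hΔ y
    have hkΔ : red k ∈ Δ := by rw [hky]; exact y.2
    have hyk : y = ⟨red k, hkΔ⟩ := Subtype.ext hky.symm
    subst hyk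
    obtain ⟨hs, hT⟩ := hop k hkΔ
    obtain ⟨G, Ĝ, hG⟩ := 𝓜.exists_isBaseChangeVia_classifyingMap 𝓜.M
      ({ 𝓜.univ with level := 𝓜.univ.level.twist (red k), symplectic := hs } :
        PolarizedAbelianSchemeWithLevel g N δ 𝓜.M.left)
    rw [← hT] at hG
    obtain ⟨hl, hh, hP, hlam⟩ := hG
    have hl₀ : (𝓜.univ.level.changeLevel N₀ d hd hN).IsBaseChangeVia (𝓜.univ.level.changeLevel N₀ d hd hN)
        (act ⟨red k, hkΔ⟩).inv.left G := by
      have h := hl.changeLevel 𝓜.univ.level N₀ d hd hN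
      rwa [LevelStructure.changeLevel_twist_of_map_eq_one 𝓜.univ.level (red k) d hd hN
        (map_castHom_eq_one_of_mem' (δ := δ) hd red hred k hkN₀)] at h
    exact ⟨G, Ĝ, ⟨hl₀, hh, hP, hlam⟩⟩
  have hex : ∀ x : Δ, ∃ (G : 𝓜.univ.A.X.left ⟶ 𝓜.univ.A.X.left)
      (Ĝ : 𝓜.univ.D.hat.X.left ⟶ 𝓜.univ.D.hat.X.left), X.IsBaseChangeVia X (act x).hom.left G Ĝ := by
    intro x
    have h := hex_inv x⁻¹
    rwa [map_inv] at h
  choose G Ĝ hG using hex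
  -- (2) uniqueness of lifts (rigidity over the finite-type `ℚ`-scheme `M`, `3 ≤ N₀`)
  have huniq : ∀ {f : 𝓜.M.left ⟶ 𝓜.M.left} {G₁ G₂ : 𝓜.univ.A.X.left ⟶ 𝓜.univ.A.X.left}
      {Ĝ₁ Ĝ₂ : 𝓜.univ.D.hat.X.left ⟶ 𝓜.univ.D.hat.X.left},
      X.IsBaseChangeVia X f G₁ Ĝ₁ → X.IsBaseChangeVia X f G₂ Ĝ₂ → G₁ = G₂ ∧ Ĝ₁ = Ĝ₂ :=
    fun h₁ h₂ => PolarizedAbelianSchemeWithLevel.IsBaseChangeVia.unique_of_locallyOfFiniteType (F := ℚ)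
      (by rw [Cardinal.mk_eq_aleph0]) 𝓜.M.hom hN₀ h₁ h₂
  -- (3) the laws: unit and multiplication
  have hG1 : G 1 = 𝟙 _ ∧ Ĝ 1 = 𝟙 _ := by
    have h := hG 1
    rw [map_one] at h
    exact huniq h (PolarizedAbelianSchemeWithLevel.IsBaseChangeVia.refl X)
  have hGmul : ∀ x y : Δ, G (x * y) = G y ≫ G x ∧ Ĝ (x * y) = Ĝ y ≫ Ĝ x := fun x y => by
    have h := hG (x * y)
    rw [map_mul, Aut.Aut_mul_def] at h
    exact huniq h ((hG y).trans (hG x))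
  -- (4) the automorphisms and the homomorphisms
  have hGinv₁ : ∀ x : Δ, G x ≫ G x⁻¹ = 𝟙 _ := fun x => by rw [← (hGmul x⁻¹ x).1, inv_mul_cancel, hG1.1]
  have hGinv₂ : ∀ x : Δ, G x⁻¹ ≫ G x = 𝟙 _ := fun x => by rw [← (hGmul x x⁻¹).1, mul_inv_cancel, hG1.1]
  have hĜinv₁ : ∀ x : Δ, Ĝ x ≫ Ĝ x⁻¹ = 𝟙 _ := fun x => by rw [← (hGmul x⁻¹ x).2, inv_mul_cancel, hG1.2]
  have hĜinv₂ : ∀ x : Δ, Ĝ x⁻¹ ≫ Ĝ x = 𝟙 _ := fun x => by rw [← (hGmul x x⁻¹).2, mul_inv_cancel, hG1.2]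
  let autA : Δ →* Aut 𝓜.univ.A.X.left :=
    { toFun := fun x => ⟨G x, G x⁻¹, hGinv₁ x, hGinv₂ x⟩
      map_one' := Iso.ext hG1.1
      map_mul' := fun x y => Iso.ext (hGmul x y).1 }
  let autAh : Δ →* Aut 𝓜.univ.D.hat.X.left :=
    { toFun := fun x => ⟨Ĝ x, Ĝ x⁻¹, hĜinv₁ x, hĜinv₂ x⟩
      map_one' := Iso.ext hG1.2
      map_mul' := fun x y => Iso.ext (hGmul x y).2 }
  exact ⟨autA, autAh, fun x => hG x⟩

end SiegelFineModuliScheme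

end Literature.AlgebraicGeometry.ModuliOfAbelianVarieties

end
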